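import Mathlib
import HarnessLib
import Literature.Analysis.FluidPDE.SelfSimilar
import Literature.Analysis.FluidPDE.SelfSimilarLiouville
import Literature.Analysis.FluidPDE.ForwardRDSSExistence
import Literature.Analysis.FluidPDE.PineauVicolRSS
import Literature.Analysis.FluidPDE.PineauVicolRSSHolds
import Literature.Analysis.FluidPDE.PineauVicolRDSSLiouvilleHolds
import Literature.Analysis.FluidPDE.AncientAxisymmetricTypeILiouville
import Literature.Analysis.FluidPDE.LocalTypeI
import Summits.NavierStokesRegularity.NavierStokesRegularity.Theorems.TypeIDSSLiouvilleConjecture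
import Summits.NavierStokesRegularity.NavierStokesRegularity.Theses.FilamentSkeletonRss
import Summits.NavierStokesRegularity.NavierStokesRegularity.Theses.CoriolisHead
import Summits.NavierStokesRegularity.NavierStokesRegularity.Theorems.CoriolisHeadCounterRotatingLiouville
import Summits.NavierStokesRegularity.NavierStokesRegularity.Theorems.TypeICertificateLadderTargetRssStratumHelical

/-!
# Blow-up scenario census, block R: ROTATING / helical-in-log-time self-similar profiles (RSS / RDSS)

Cell `pub/ns-census` (director-ns KEY req102, D-0154 (A), 2026-08-28), typer seat `ns-census-typer-2`.
Kernel-checked INDEX of block R of `SCENARIO-CENSUS.md` v1.1 (ns-census-lead; row keys fixed there):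
backward (blow-up) profiles that are self-similar up to a rotation — rotated self-similar (RSS,
`Literature.Analysis.FluidPDE.IsRSS α u`: `u(x,t) = λ R(2α log λ) u(λ R(−2α log λ)x, λ²t)` for ALL
`λ > 0`, equivalently the Pineau–Vicol ansatz `pvAnsatz α U`) and rotated discretely self-similar (RDSS,
`IsRotatedDSS c R u` for ONE factor `c > 1` and a linear isometry `R`), all with a Type I bound
(`HasTypeIDecay C₀ u`: `‖u(t,x)‖ ≤ C₀/(‖x‖ + √(−t))`). The un-rotated λ-DSS rows (R = 1) are block D
(`ScenarioCensusSelfSimilar.lean`, typer-1); the leaf `TypeIDSSLiouvilleConjecture` (λ-DSS ∧ RDSS for all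
factors and rotations) is cited by both files and typed as a row here through its RDSS conjunct (R4),
which is in fact equivalent to the whole leaf (`row_R4_iff_typeIDSSLiouvilleConjecture`, since `R = 1`
is a rotation). Sister files: `ScenarioCensusAncient.lean`, `ScenarioCensusSteady.lean` (this seat).

## What a row is

`Row_<key> : Prop` = the exact Liouville statement of census cell `<key>` over the tree predicates
(`IsAncientMildSolution`, `IsRSS`, `IsRotatedDSS`, `HasTypeIDecay`, `IsAxisymmetric`, `pvAnsatz`,
`IsClassicalNSSolutionOn`); when the tree already holds the statement (named fact / leaf / route decl)
the row IS that declaration by name. `EXCLUDED-IN-TREE` ⇔ `theorem row_<key>_excluded : Row_<key>`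
below; `OPEN-…` rows carry only the one-line implications between rows and to/from the ledger's items.

| key | cell | `Row_…` body | value |
|---|---|---|---|
| R1 | RSS, ∣α∣ < α₁ or ∣α∣ > α₂ · classical Type I on [−1,0), C² profile | fact `pineauVicol2026_rss_liouville` (PV 2026 Thm 1.4) | EXCLUDED-IN-TREE |
| R2 | RSS, every α (the window α ≈ 1) · ancient mild, Type I | statement over `IsRSS` (⇐ R4; refuted by ⟨16274⟩ `RssProfileExists` via R4) | OPEN-WITH-LINE |
| R2b | rotated Leray profile has signed Coriolis defect | item `CoriolisHead.NoCoRotatingCore` ⟨22676⟩ | OPEN-WITH-LINE |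
| R3 | RDSS, (∣α∣ ≤ α₁ ∧ 1 < c < c₁) ∨ (∣α∣ ≥ α₂ ∧ c < c₂^{1/(1+α²)}) | fact `pineauVicol2026_rdss_liouville` (PV 2026 Thm 1.7) | EXCLUDED-IN-TREE |
| R4 | RDSS general (c > 1, R ∈ O(3)) · ancient mild, Type I | `∀ c R, RotatedTypeIDSSLiouville c R` (↔ leaf `TypeIDSSLiouvilleConjecture`) | OPEN-WITH-LINE |
| R5 | RSS / RDSS · axisymmetric | statement (RDSS + axisym + Type I ⇒ 0) | EXCLUDED-IN-TREE |
| R6a | rotated Leray profile, counter-rotating (signed defect) ⇒ constant | item `CoriolisHead.CounterRotatingLiouville` ⟨22677⟩ | EXCLUDED-IN-TREE |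

Markdown-only rows: R6 b–d (`STH.rdssClass_corotatingMirror_empty`, `…mirrorCorotating_empty`,
`…tiltedRigidRotation_empty`: profile classes of route DssFarFieldSlaving, long bespoke statements — cited,
not restated), R7 (Type-II rotating profiles: no template, OPEN-NO-LINE), R8 (helical screw-symmetric
profiles: NO-VOCAB / vacuous under `HasTypeIDecay`). Mechanism rows (census §4): RSS filament ⟨21220⟩,
⟨21221⟩ → R2; CoriolisHead ⟨22676⟩ → R2b / R6a. No summit statement is proved or claimed here; nothing in
this file is a claim about Navier–Stokes regularity.
-/

noncomputable section

set_option linter.dupNamespace false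

open MeasureTheory Set Filter Topology
open scoped ENNReal NNReal

namespace Summit.NavierStokesRegularity.NavierStokesRegularity.Theorems.ScenarioCensus

open Literature.Analysis

/-- Census row R1 — (Type I · RSS with rotation rate `|α| < α₁` or `|α| > α₂` · classical on
`[−1,0) × ℝ³` with the Type I bound `C₀/(‖x‖+√(−t))`, profile `U ∈ C²` in the ansatz `pvAnsatz α`):
`U ≡ 0` (Pineau–Vicol 2026 Thm 1.4; thresholds depend on `C₀`), BY NAME the fact
`pineauVicol2026_rss_liouville`. Value: EXCLUDED-IN-TREE. -/
def Row_R1 : Prop :=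
  FluidPDE.pineauVicol2026_rss_liouville

/-- R1 is EXCLUDED-IN-TREE: `pineauVicol2026_rss_liouville_holds`. -/
theorem row_R1_excluded : Row_R1 :=
  FluidPDE.pineauVicol2026_rss_liouville_holds

/-- Census row R2 — (Type I · RSS, EVERY angular speed `α` · ancient mild, measurable slices): a rotated
self-similar (`IsRSS α u`) ancient mild solution (`ν = 1`) with a Type I bound `‖u‖ ≤ C₀/(‖x‖+√(−t))`
vanishes a.e. on every slice `t < 0` — Tsai's Conjecture 8.9 / Pineau–Vicol Conjecture 1.1 in the tree's
ancient-mild class; the window `α ≈ 1` is what R1 leaves open. Value: OPEN-WITH-LINE (existence side: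
hard core ⟨16274⟩ `FilamentSkeletonRss.RssProfileExists` with cruxes ⟨21220⟩, ⟨21221⟩; see
`not_rssProfileExists_of_row_R4`). -/
def Row_R2 : Prop :=
  ∀ (α : ℝ) (u : ℝ → EuclideanSpace ℝ (Fin 3) → EuclideanSpace ℝ (Fin 3)),
    FluidPDE.IsAncientMildSolution 1 u → (∀ t < 0, AEStronglyMeasurable (u t) volume) →
      FluidPDE.IsRSS α u → (∃ C₀ : ℝ, FluidPDE.HasTypeIDecay C₀ u) → ∀ t < 0, u t =ᵐ[volume] 0

/-- Census row R2b — (rotated Leray profiles, any `ν`, `a > 0`, any skew frame `B`, smooth bounded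
`U`): the Coriolis defect is signed everywhere, `tr(B ∘ DU) ≥ 0` ("no co-rotating core"), BY NAME the
route item `CoriolisHead.NoCoRotatingCore` (⟨22676⟩; with R6a it makes every bounded rotated profile
constant). Value: OPEN-WITH-LINE (line `far_field_constancy`). -/
def Row_R2b : Prop :=
  Summit.NavierStokesRegularity.NavierStokesRegularity.Theses.CoriolisHead.NoCoRotatingCore

/-- Census row R3 — (Type I · RDSS in the Pineau–Vicol regimes: `|α| ≤ α₁` and `1 < c < c₁`, or
`|α| ≥ α₂` and `c < c₂^{1/(1+α²)}` · classical on `[−1,0)`, `C²` space–log-time profile): the profile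
vanishes (Pineau–Vicol 2026 Thm 1.7), BY NAME the fact `pineauVicol2026_rdss_liouville`.
Value: EXCLUDED-IN-TREE. -/
def Row_R3 : Prop :=
  FluidPDE.pineauVicol2026_rdss_liouville

/-- R3 is EXCLUDED-IN-TREE: `pineauVicol2026_rdss_liouville_holds`. -/
theorem row_R3_excluded : Row_R3 :=
  FluidPDE.pineauVicol2026_rdss_liouville_holds

/-- Census row R4 — (Type I · RDSS, EVERY factor `c > 1` and EVERY linear isometry `R` of `ℝ³` ·
ancient mild, measurable slices): `∀ c R, RotatedTypeIDSSLiouville c R` (Bradshaw–Tsai 2017 Open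
Problem 5.1, Tsai Conj. 8.8–8.9). Value: OPEN-WITH-LINE (routes DulacContraction
`RDSSLiouvilleInClass`, QuarterTurnRdss, CoriolisHead; negative item ⟨0155⟩ of block D). Equivalent to
the whole leaf `TypeIDSSLiouvilleConjecture` (`row_R4_iff_typeIDSSLiouvilleConjecture`). -/
def Row_R4 : Prop :=
  ∀ (c : ℝ) (R : EuclideanSpace ℝ (Fin 3) ≃ₗᵢ[ℝ] EuclideanSpace ℝ (Fin 3)),
    FluidPDE.RotatedTypeIDSSLiouville c R

/-- R4 ⇔ the canonical leaf `TypeIDSSLiouvilleConjecture` (= `∀ c, TypeIDSSLiouville c ∧ ∀ R,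
RotatedTypeIDSSLiouville c R`): the un-rotated conjunct is the case `R = 1`
(`rotatedTypeIDSSLiouville_refl_iff`). -/
theorem row_R4_iff_typeIDSSLiouvilleConjecture :
    Row_R4 ↔ Summit.NavierStokesRegularity.NavierStokesRegularity.TypeIDSSLiouvilleConjecture := by
  refine ⟨fun h c => ⟨?_, fun R => h c R⟩, fun h c R => (h c).2 R⟩
  exact (FluidPDE.rotatedTypeIDSSLiouville_refl_iff c).1 (h c (LinearIsometryEquiv.refl ℝ _))

/-- R4 ⇒ R2: an RSS field with speed `α` is RDSS with factor `2` and rotation `rotZLIE (2α log 2)`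
(`IsRSS` unfolds to `IsRotatedDSS` for every factor). -/
theorem row_R2_of_row_R4 (h : Row_R4) : Row_R2 :=
  fun α u hu hmeas hrss hdec =>
    h 2 (FluidPDE.rotZLIE (2 * α * Real.log 2)) one_lt_two u hu hmeas (hrss 2 two_pos) hdec

/-- The existence hard core ⟨16274⟩ `FilamentSkeletonRss.RssProfileExists` REFUTES row R4 (hence the
leaf `TypeIDSSLiouvilleConjecture`): its rotated self-similar solution is RDSS with factor `2` for the
rotation `Rot(−2α log 2)`, so R4 makes the slice `u(−1) = U` a.e. zero, and `U ∈ C²` is then zero,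
contradicting `U ≠ 0`. -/
theorem not_rssProfileExists_of_row_R4 (h : Row_R4) :
    ¬ Summit.NavierStokesRegularity.NavierStokesRegularity.Theses.FilamentSkeletonRss.RssProfileExists := by
  rintro ⟨α, C₀, U, Rot, u, _, _, hU2, hUne, hu1, hrdss, hmild, hmeas, hdec⟩
  have hae : u (-1) =ᵐ[volume] 0 :=
    h 2 (Rot (-(α * (2 * Real.log 2)))) one_lt_two u hmild hmeas (hrdss 2 two_pos) ⟨C₀, hdec⟩
      (-1) (by norm_num)
  rw [hu1] at hae
  exact hUne ((hU2.continuous.ae_eq_iff_eq volume continuous_const).1 hae)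

/-- Census row R5 — (Type I · RSS / RDSS with ANY factor and rotation · axisymmetric about `e₃` at every
`t < 0` · ancient mild, measurable slices): the field vanishes a.e. on every slice — the rotated-DSS
structure is not even needed (KNSS 2009 Thm 5.3 corollary; census D7b / A2b). Value: EXCLUDED-IN-TREE. -/
def Row_R5 : Prop :=
  ∀ (c : ℝ) (R : EuclideanSpace ℝ (Fin 3) ≃ₗᵢ[ℝ] EuclideanSpace ℝ (Fin 3))
    (u : ℝ → EuclideanSpace ℝ (Fin 3) → EuclideanSpace ℝ (Fin 3)),
    FluidPDE.IsAncientMildSolution 1 u → (∀ t < 0, AEStronglyMeasurable (u t) volume) →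
      FluidPDE.IsRotatedDSS c R u → (∃ C₀ : ℝ, FluidPDE.HasTypeIDecay C₀ u) →
        (∀ t < 0, FluidPDE.IsAxisymmetric (u t)) → ∀ t < 0, u t =ᵐ[volume] 0

/-- R5 is EXCLUDED-IN-TREE: `rotatedTypeIDSSLiouville_of_isAxisymmetric`. -/
theorem row_R5_excluded : Row_R5 :=
  fun c R u hu hmeas hdss hdec haxi =>
    FluidPDE.rotatedTypeIDSSLiouville_of_isAxisymmetric c R u hu hmeas hdss hdec haxi

/-- Census row R6a — (rotated Leray profile `−νΔU + aU + a(y·∇)U + (BU − ∇U·By) + (U·∇)U + ∇P = 0`,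
`B` skew, `U` smooth and bounded, with signed Coriolis defect `tr(B ∘ DU) ≥ 0` everywhere): `U` is
constant — Tsai 1998 Thm 1 (`q = ∞`) is the case `B = 0` —, BY NAME the route item
`CoriolisHead.CounterRotatingLiouville` (⟨22677⟩, closed·proved). Value: EXCLUDED-IN-TREE. -/
def Row_R6a : Prop :=
  Summit.NavierStokesRegularity.NavierStokesRegularity.Theses.CoriolisHead.CounterRotatingLiouville

/-- R6a is EXCLUDED-IN-TREE: `Theorems.counterRotatingLiouville_proof` (the item's closing theorem). -/
theorem row_R6a_excluded : Row_R6a :=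
  counterRotatingLiouville_proof

/-- R2b and R6a together: if no bounded rotated profile has a co-rotating core (R2b, open), every smooth
bounded rotated Leray profile is constant (by R6a, proved). -/
theorem rotatedProfile_const_of_row_R2b (h : Row_R2b) :
    ∀ (ν a : ℝ), 0 < ν → 0 < a →
      ∀ (B : EuclideanSpace ℝ (Fin 3) →L[ℝ] EuclideanSpace ℝ (Fin 3))
        (U : EuclideanSpace ℝ (Fin 3) → EuclideanSpace ℝ (Fin 3)) (P : EuclideanSpace ℝ (Fin 3) → ℝ),
        ContDiff ℝ (⊤ : ℕ∞) U → ContDiff ℝ 2 P → (∀ x, inner ℝ (B x) x = 0) →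
        FluidPDE.VectorCalculus.IsDivFree U →
        (∀ y, -(ν • Laplacian.laplacian U y) + a • U y + a • fderiv ℝ U y y +
            (B (U y) - fderiv ℝ U y (B y)) + FluidPDE.convect U U y + gradient P y = 0) →
        (∃ M : ℝ, ∀ y, ‖U y‖ ≤ M) → ∃ b : EuclideanSpace ℝ (Fin 3), ∀ y, U y = b :=
  fun ν a hν ha B U P hU hP hB hdiv heq hbdd =>
    row_R6a_excluded ν a hν ha B U P hU hP hB hdiv heq hbdd (h ν a hν ha B U P hU hP hB hdiv heq hbdd)

/-! ## Appendix 1 (append-only round 2): the HELICAL stratum of the RSS profiles (census R8) -/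

/-- Census row R8 — (Type I · RSS of ANY angular speed `α`, Pineau–Vicol class: classical on `[−1,0)`,
envelope `C₀/(‖x‖+√(−t))`, `C²` profile `U` in `pvAnsatz α` · HELICAL: the profile is equivariant under
a screw motion about the axis with non-zero pitch, `U(R_ψ y + h e₃) = R_ψ U(y)`, `h ≠ 0`): `U = 0` — the
screw orbit is unbounded, so the decaying profile vanishes along it (no Navier–Stokes input beyond the
class). Restated verbatim from the tree theorem `Theorems.rssStratum_helical` (crux ⟨1217⟩, line
`killing-twisted-bernoulli-solitons`, stub B5b; ref flag F5). Value: EXCLUDED-IN-TREE (vacuous stratum);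
the ancient-side twin is `Row_A8v` of `ScenarioCensusAncientSymmetry.lean`. -/
def Row_R8 : Prop :=
  ∀ (C₀ α ψ h : ℝ), h ≠ 0 →
    ∀ (u : ℝ → EuclideanSpace ℝ (Fin 3) → EuclideanSpace ℝ (Fin 3))
      (p : ℝ → EuclideanSpace ℝ (Fin 3) → ℝ) (U : EuclideanSpace ℝ (Fin 3) → EuclideanSpace ℝ (Fin 3)),
      FluidPDE.IsClassicalNSSolutionOn (Set.Ico (-1) 0) 1 0 u p →
      (∀ t ∈ Set.Ico (-1 : ℝ) 0, ∀ x : EuclideanSpace ℝ (Fin 3),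
          ‖u t x‖ ≤ C₀ / (‖x‖ + Real.sqrt (-t))) →
      ContDiff ℝ 2 U →
      (∀ t ∈ Set.Ico (-1 : ℝ) 0, ∀ x : EuclideanSpace ℝ (Fin 3),
          u t x = FluidPDE.pvAnsatz α (fun y _ => U y) t x) →
      (∀ y : EuclideanSpace ℝ (Fin 3),
          U (FluidPDE.rotZ ψ y + h • EuclideanSpace.single 2 (1 : ℝ)) = FluidPDE.rotZ ψ (U y)) →
      U = 0

/-- R8 is EXCLUDED-IN-TREE: `Theorems.rssStratum_helical`. -/
theorem row_R8_excluded : Row_R8 :=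
  rssStratum_helical

/-! ## Appendix 2 (append-only round 3): census R7 — rotating profiles of ANY type (rough profile) -/

/-- Census row R7 — (Type II, indeed ANY type · rotated discretely self-similar with ANY factor `c > 1`
and ANY linear isometry `R` · LOCAL ENERGY class, rough profile allowed): an RDSS field `u`
(`c Rᵀ u(c²t, cRx) = u(t,x)`, `IsRotatedDSS c R u`) which with some pressure `p` is a suitable weak
solution of Navier–Stokes (`ν = 1`) in the unit backward parabolic ball `Q((0,0),1)` in the
Albritton–Barker local-energy class (`IsSuitableWeakSolutionInBall 1 (0,0) u p`) is NOT singular at the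
vertex `(0,0)`. The rotated twin of typer-1's `Row_D8` (same class, `R = 1`) and the union of R4 (Type I)
with the rough-profile cell; known sub-cells R1/R3 (Pineau–Vicol regimes), R5 (axisymmetric), R6a, R8.
Value: OPEN-NO-LINE (census §5 #3: no template in print or tree). -/
def Row_R7 : Prop :=
  ∀ (c : ℝ), 1 < c → ∀ (R : EuclideanSpace ℝ (Fin 3) ≃ₗᵢ[ℝ] EuclideanSpace ℝ (Fin 3))
    (u : ℝ → EuclideanSpace ℝ (Fin 3) → EuclideanSpace ℝ (Fin 3))
    (p : ℝ → EuclideanSpace ℝ (Fin 3) → ℝ),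
    FluidPDE.IsRotatedDSS c R u →
    FluidPDE.IsSuitableWeakSolutionInBall 1 ((0 : ℝ), (0 : EuclideanSpace ℝ (Fin 3))) u p →
    ¬ FluidPDE.IsBackwardSingularPoint u ((0 : ℝ), (0 : EuclideanSpace ℝ (Fin 3)))

/-- R7 contains the un-rotated cell: with `R = 1` it is literally typer-1's `Row_D8` statement
(`isRotatedDSS_refl_iff`), restated here as a Prop-level implication to avoid a cross-file import. -/
theorem row_R7_refl (h : Row_R7) :
    ∀ (c : ℝ), 1 < c → ∀ (u : ℝ → EuclideanSpace ℝ (Fin 3) → EuclideanSpace ℝ (Fin 3))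
      (p : ℝ → EuclideanSpace ℝ (Fin 3) → ℝ),
      FluidPDE.IsDiscretelySelfSimilar c u →
      FluidPDE.IsSuitableWeakSolutionInBall 1 ((0 : ℝ), (0 : EuclideanSpace ℝ (Fin 3))) u p →
      ¬ FluidPDE.IsBackwardSingularPoint u ((0 : ℝ), (0 : EuclideanSpace ℝ (Fin 3))) :=
  fun c hc u p hdss hsw =>
    h c hc (LinearIsometryEquiv.refl ℝ _) u p (FluidPDE.isRotatedDSS_refl_iff.2 hdss) hsw

end Summit.NavierStokesRegularity.NavierStokesRegularity.Theorems.ScenarioCensus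

end
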